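import Mathlib.Algebra.Category.ModuleCat.Basic
import Mathlib.LinearAlgebra.Quotient.Basic
import Literature.Topology.FourManifolds.KhComplex
import Literature.Topology.FourManifolds.LeeRasmussen
import HarnessLib

/-!
# The round unknot has no Khovanov homology off the bidegrees `(0, ±1)`:
discharge of `isZero_khovanovHomology_empty`

Sibling proof file of `KhComplex.lean` (D-0014: named facts `def X : Prop` are discharged as
`theorem X_holds : X`). It discharges

* `Literature.Topology.FourManifolds.GaussDiagram.isZero_khovanovHomology_empty_holds :
  isZero_khovanovHomology_empty` — **the integral Khovanov homology `Kh^{i,j}` of the empty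
  Gauss diagram (the round unknot diagram) is a zero object of `ModuleCat ℤ` for every bidegree
  `(i, j) ∉ {(0, 1), (0, -1)}`.**
* `Literature.Topology.FourManifolds.GaussDiagram.nonempty_iso_frobeniusHomology_homology_holds :
  nonempty_iso_frobeniusHomology_homology` — **for a realisable Gauss diagram, every `(h, t)` and
  every degree `i`, the concrete subquotient
  `frobeniusHomology R h t i = ker dᵢ ⧸ (im dᵢ₋₁ ⊓ ker dᵢ)` of the Khovanov complex over
  `A = R[X]/(X² - hX - t)` is isomorphic to the categorical homology
  (`HomologicalComplex.homology`) of the cochain complex `frobeniusComplex R h t hd hG` in degree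
  `i`** (Khovanov (2000), §7: the cohomology groups of the cube complex are the `ker d ⧸ im d` of
  its differential). See the section *The concrete homology is the categorical homology* below;
  the content is Mathlib's homology API for `ModuleCat R`, no knot theory is involved.
* `Literature.Topology.FourManifolds.GaussDiagram.finrank_khovanovHomology_empty_zero_one_holds :
  finrank_khovanovHomology_empty_zero_one` and
  `Literature.Topology.FourManifolds.GaussDiagram.finrank_khovanovHomology_empty_zero_neg_one_holds :
  finrank_khovanovHomology_empty_zero_neg_one` — **`Kh^{0,1}` and `Kh^{0,-1}` of the empty Gauss
  diagram (round unknot) are free of rank one** (Khovanov (2000), §7.1 with §4.2; Bar-Natan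
  (2002), §3.2). See the section *`Kh^{0,±1}(◯) ≅ ℤ`* at the end of the file.

Source. Khovanov (2000), §4.2: the cube, hence the complex, of a crossingless plane diagram
consisting of `k` circles is `A^{⊗ k}` at the single vertex of the `0`-dimensional cube, where
`A` is free on `𝟙`, `X` with `deg 𝟙 = 1`, `deg X = -1` (§2.2); over `ℤ` at `c = 0` (§7.1) the
round unknot (`k = 1`) therefore has cohomology `ℤ` in bidegrees `(0, 1)`, `(0, -1)` and `0`
elsewhere. Bar-Natan (2002), §3.2 uses the same normalisation (`Kh(◯)` is `ℚ` in `q`-degrees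
`±1`, height `0`).

Proof (in the enhanced-state model of `KhComplex`, using the unknot lemmas of `LeeRasmussen`).
The empty diagram has no chord, so every state has weight `0` and `n₊ = n₋ = 0`
(`State.weight_empty`, `nPlus_empty`, `nMinus_empty`), whence every enhanced state has
homological degree `0` (`homDegree_empty`); it has one arc (`arcCount = max 0 1 = 1`) and one
state circle (`card_stateCircle_empty`), so the quantum degree of an enhanced state is `1` if
its circle is labelled `𝟙` and `-1` if it is labelled `X` (`qDegree_empty`). Hence for
`(i, j) ∉ {(0, 1), (0, -1)}` the basis `bidegStates i j` of the bigraded cochain group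
`C^{i,j} = (bidegStates i j → ℤ)` is empty (`isEmpty_bidegStates_empty`), the cochain group and
its submodule `ker d` are subsingletons, and so is the subquotient
`Kh^{i,j} = ker d ⧸ (im d ⊓ ker d)`, which is thus a zero object
(`ModuleCat.isZero_of_subsingleton`). No realisability or `d² = 0` input is needed.

## References

* M. Khovanov, *A categorification of the Jones polynomial*, Duke Math. J. 101 (2000)
  359–426 (arXiv:math/9908171), §2.2 (the algebra `A`, `deg 𝟙 = 1`, `deg X = -1`), §4.2
  (cubes and complexes of plane diagrams; `k` disjoint circles give `A^{⊗ k}`), §7.1 (the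
  groups `H^{i,j}` at `c = 0`). [cite: Khovanov2000, §4.2]
* D. Bar-Natan, *On Khovanov's categorification of the Jones polynomial*, Algebr. Geom.
  Topol. 2 (2002) 337–370, §3.2 (gradings; the unknot). [cite: BarNatan2002, §3.2]
-/

open CategoryTheory

noncomputable section

namespace Literature.Topology.FourManifolds

namespace GaussDiagram

/-- Every enhanced state of the empty diagram (round unknot) has quantum degree `1` (its single
state circle labelled `𝟙`) or `-1` (labelled `X`): `deg 𝟙 = 1`, `deg X = -1`, and the shift
`|s| + n₊ - 2 n₋` vanishes. Khovanov (2000), §2.2; Bar-Natan (2002), §3.2 (the unknot).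
[cite: Khovanov2000, §2.2] -/
theorem qDegree_empty (s : GaussDiagram.empty.EnhancedState) :
    qDegree s = 1 ∨ qDegree s = -1 := by
  haveI : Subsingleton GaussDiagram.empty.Arc := inferInstanceAs (Subsingleton (Fin 1))
  haveI : Subsingleton (GaussDiagram.empty.StateCircle s.state) :=
    Fintype.card_le_one_iff_subsingleton.mp (card_stateCircle_empty s.state).le
  have a₀ : GaussDiagram.empty.Arc := ⟨0, by simp [arcCount]⟩
  -- the single state circle, counted once
  have huniv : (Finset.univ : Finset (GaussDiagram.empty.StateCircle s.state)).card = 1 := by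
    rw [Finset.card_univ, Fintype.card_eq_one_iff]
    exact ⟨GaussDiagram.empty.circleOf s.state a₀, fun _ ↦ Subsingleton.elim _ _⟩
  -- the circles labelled `b` are all of them or none, according to the label of the arc `a₀`
  have hfilt : ∀ b : Bool,
      (Finset.univ.filter fun c : GaussDiagram.empty.StateCircle s.state ↦
        ∃ a, GaussDiagram.empty.circleOf s.state a = c ∧ s.label a = b) =
      if s.label a₀ = b then Finset.univ else ∅ := by
    intro b
    split_ifs with hb
    · exact Finset.filter_eq_self.mpr fun c _ ↦ ⟨a₀, Subsingleton.elim _ _, hb⟩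
    · refine Finset.filter_eq_empty_iff.mpr fun c _ h ↦ hb ?_
      obtain ⟨a, -, ha⟩ := h
      rwa [Subsingleton.elim a₀ a]
  rw [qDegree, hfilt false, hfilt true, State.weight_empty, nPlus_empty, nMinus_empty]
  cases s.label a₀ <;> simp [huniv]

/-- The empty diagram (round unknot) has no enhanced state of bidegree `(i, j)` unless
`(i, j) = (0, 1)` or `(0, -1)`: off these two bidegrees the basis `bidegStates i j` of the
bigraded cochain group `C^{i,j}` is empty (`homDegree_empty`, `qDegree_empty`).
Khovanov (2000), §4.2 with §2.2; Bar-Natan (2002), §3.2. [cite: Khovanov2000, §4.2] -/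
theorem isEmpty_bidegStates_empty {i j : ℤ} (hij : (i, j) ≠ (0, 1) ∧ (i, j) ≠ (0, -1)) :
    IsEmpty (GaussDiagram.empty.bidegStates i j) := by
  refine ⟨fun s ↦ ?_⟩
  obtain ⟨s, hi, hj⟩ := s
  have h0 := homDegree_empty s
  rcases qDegree_empty s with hq | hq
  · exact hij.1 (by rw [← hi, ← hj, h0, hq])
  · exact hij.2 (by rw [← hi, ← hj, h0, hq])

/-- **The round unknot has no Khovanov homology off the bidegrees `(0, 1)`, `(0, -1)`**: the
named fact `isZero_khovanovHomology_empty` of `KhComplex` holds. For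
`(i, j) ∉ {(0, 1), (0, -1)}` the basis `bidegStates i j` of `C^{i,j}` is empty
(`isEmpty_bidegStates_empty`), so the cochain group `bidegStates i j → ℤ`, its submodule
`ker d` and the subquotient `Kh^{i,j} = ker d ⧸ (im d ⊓ ker d)` are subsingletons, i.e.
`khovanovHomology i j` is a zero object of `ModuleCat ℤ`. Khovanov (2000), §4.2 (a
crossingless diagram of `k` circles has the complex `A^{⊗ k}` at the single vertex of the
`0`-cube), §2.2 (`A` free on `𝟙`, `X` of degrees `1`, `-1`), §7.1 (`c = 0`); Bar-Natan (2002),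
§3.2. [cite: Khovanov2000, §4.2] -/
theorem isZero_khovanovHomology_empty_holds : isZero_khovanovHomology_empty := by
  intro i j hij
  have he := isEmpty_bidegStates_empty hij
  -- `C^{i,j}`, `ker d` and `ker d ⧸ (im d ⊓ ker d)` are subsingletons
  have hk : Subsingleton (LinearMap.ker (GaussDiagram.empty.khovanovDQ i (i + 1) j)) :=
    ⟨fun x y ↦ Subtype.ext (funext fun a ↦ he.elim a)⟩
  have hq : Subsingleton (LinearMap.ker (GaussDiagram.empty.khovanovDQ i (i + 1) j) ⧸
      (LinearMap.range (GaussDiagram.empty.khovanovDQ (i - 1) i j)).comap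
        (LinearMap.ker (GaussDiagram.empty.khovanovDQ i (i + 1) j)).subtype) := by
    refine ⟨fun x y ↦ ?_⟩
    obtain ⟨x, rfl⟩ := Submodule.Quotient.mk_surjective _ x
    obtain ⟨y, rfl⟩ := Submodule.Quotient.mk_surjective _ y
    rw [Subsingleton.elim x y]
  exact @ModuleCat.isZero_of_subsingleton ℤ _ (GaussDiagram.empty.khovanovHomology i j) hq

/-! ## The concrete homology is the categorical homology:
discharge of `nonempty_iso_frobeniusHomology_homology`

* `frobeniusComplex_d`: every differential `d i j` of `frobeniusComplex` (a `CochainComplex.of`)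
  is `ModuleCat.ofHom (khovanovD R h t i j)` — on the nose for `j = i + 1`
  (`CochainComplex.of_d`), and both sides vanish otherwise (`CochainComplex.of_d_ne`,
  `khovanovD_eq_zero_of_ne`); this is cast-free because `khovanovD` is defined between two
  arbitrary degrees.
* `HomologicalComplex.homologyIsoSc'` (with `CochainComplex.prev`/`CochainComplex.next`) computes
  the homology in degree `i` from the short complex `C^{i-1} → Cⁱ → C^{i+1}`, which is isomorphic
  (`ShortComplex.isoMk` with identity components) to the short complex of modules
  `ShortComplex.moduleCatMk (khovanovD (i-1) i) (khovanovD i (i+1))`.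
* `ShortComplex.moduleCatHomologyIso` identifies the homology of the latter with
  `ker dᵢ ⧸ range (dᵢ₋₁ co-restricted to ker dᵢ)`, and this denominator equals
  `comap (ker dᵢ).subtype (range dᵢ₋₁)` (`Submodule.quotEquivOfEq`).

Source: M. Khovanov, *A categorification of the Jones polynomial*, Duke Math. J. 101 (2000), §7
(cohomology groups `H^{i,j}(D)` of the complex of a diagram). Mathlib:
`Mathlib.Algebra.Homology.ShortComplex.ModuleCat` (`moduleCatHomologyIso`),
`Mathlib.Algebra.Homology.ShortComplex.HomologicalComplex` (`homologyIsoSc'`). -/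

section FrobeniusHomology

variable (G : GaussDiagram) (R : Type) [CommRing R]

/-- Every differential of the cochain complex `frobeniusComplex` (built with `CochainComplex.of`)
is the incidence matrix `khovanovD` between the corresponding degrees: on the nose for
`j = i + 1` (`CochainComplex.of_d`), and both sides vanish otherwise (`CochainComplex.of_d_ne`,
`khovanovD_eq_zero_of_ne`). Mathlib plumbing for Khovanov (2000), §7 (the cube complex and its
differential). [cite: Khovanov2000, §7] -/
theorem frobeniusComplex_d (h t : R) (hd : G.khovanovD_comp_khovanovD R)
    (hG : ∃ K : Knot, K.HasGaussDiagram G) (i j : ℤ) :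
    (G.frobeniusComplex R h t hd hG).d i j = ModuleCat.ofHom (G.khovanovD R h t i j) := by
  change CochainComplex.of.d (fun i ↦ ModuleCat.of R (G.degStates i → R))
      (fun i ↦ ModuleCat.ofHom (G.khovanovD R h t i (i + 1))) i j = _
  by_cases hij : i + 1 = j
  · subst hij
    exact CochainComplex.of_d _ _ i
  · rw [CochainComplex.of_d_ne _ _ hij, G.khovanovD_eq_zero_of_ne R h t (Ne.symm hij)]
    exact ModuleCat.ofHom_zero.symm

/-- **Discharge of `nonempty_iso_frobeniusHomology_homology`.** The concrete subquotient
`frobeniusHomology R h t i = ker dᵢ ⧸ (im dᵢ₋₁ ⊓ ker dᵢ)` is isomorphic to the categorical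
homology of `frobeniusComplex` in degree `i`: by `HomologicalComplex.homologyIsoSc'` the latter
is the homology of the short complex `C^{i-1} → Cⁱ → C^{i+1}`, which is isomorphic
(`ShortComplex.isoMk` with identity components, `frobeniusComplex_d`) to the short complex of
modules built from `khovanovD (i-1) i` and `khovanovD i (i+1)`, whose homology Mathlib's
`ShortComplex.moduleCatHomologyIso` identifies with
`ker dᵢ ⧸ range (dᵢ₋₁ co-restricted to ker dᵢ)`; the two denominators agree as submodules of
`ker dᵢ` (`Submodule.quotEquivOfEq`). Khovanov (2000), §7 (homology groups of the cube complex
as `ker d ⧸ im d`). [cite: Khovanov2000, §7] -/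
theorem nonempty_iso_frobeniusHomology_homology_holds :
    G.nonempty_iso_frobeniusHomology_homology R := by
  intro h t hd hG i
  -- `d² = 0` between the degrees `i - 1`, `i`, `i + 1`
  have hfg : G.khovanovD R h t i (i + 1) ∘ₗ G.khovanovD R h t (i - 1) i = 0 := by
    have := hd h t hG (i - 1)
    rwa [sub_add_cancel] at this
  -- the model short complex of modules
  let S₀ : ShortComplex (ModuleCat R) :=
    ShortComplex.moduleCatMk (G.khovanovD R h t (i - 1) i) (G.khovanovD R h t i (i + 1)) hfg
  -- the short complex of `frobeniusComplex` around `i` is the model one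
  let eS : (G.frobeniusComplex R h t hd hG).sc' (i - 1) i (i + 1) ≅ S₀ :=
    ShortComplex.isoMk (Iso.refl _) (Iso.refl _) (Iso.refl _)
      (by
        simp [S₀, frobeniusComplex_d]
        exact (Category.id_comp _).trans (Category.comp_id _).symm)
      (by
        simp [S₀, frobeniusComplex_d]
        exact (Category.id_comp _).trans (Category.comp_id _).symm)
  have e₁ : (G.frobeniusComplex R h t hd hG).homology i ≅
      ((G.frobeniusComplex R h t hd hG).sc' (i - 1) i (i + 1)).homology :=
    (G.frobeniusComplex R h t hd hG).homologyIsoSc' (i - 1) i (i + 1)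
      (CochainComplex.prev ℤ i) (CochainComplex.next ℤ i)
  have e₂ : ((G.frobeniusComplex R h t hd hG).sc' (i - 1) i (i + 1)).homology ≅ S₀.homology :=
    ShortComplex.homologyMapIso eS
  have e₃ : S₀.homology ≅ S₀.moduleCatLeftHomologyData.H := S₀.moduleCatHomologyIso
  -- the two denominators agree as submodules of `ker dᵢ`
  have hrange : LinearMap.range S₀.moduleCatToCycles =
      (LinearMap.range (G.khovanovD R h t (i - 1) i)).comap
        (LinearMap.ker (G.khovanovD R h t i (i + 1))).subtype := by
    ext ⟨x, hx⟩
    simp only [LinearMap.mem_range]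
    constructor
    · rintro ⟨y, hy⟩
      exact ⟨y, congrArg Subtype.val hy⟩
    · rintro ⟨y, hy⟩
      exact ⟨y, Subtype.ext hy⟩
  have e₄ : S₀.moduleCatLeftHomologyData.H ≅ G.frobeniusHomology R h t i :=
    (Submodule.quotEquivOfEq _ _ hrange).toModuleIso
  exact ⟨(e₁ ≪≫ e₂ ≪≫ e₃ ≪≫ e₄).symm⟩

end FrobeniusHomology

/-! ## `Kh^{0,±1}(◯) ≅ ℤ`: discharge of `finrank_khovanovHomology_empty_zero_neg_one` and
`finrank_khovanovHomology_empty_zero_one`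

Source. Khovanov (2000), §7.1 (arXiv:math/9908171, eqs. (149)–(151)): at `c = 0` the algebra
`A` is the free abelian group of rank `2` on `𝟙`, `X`, of degrees `1`, `-1`; by §4.2 the
crossingless diagram of the unknot has the one-vertex cube over `I = ∅`, so its complex is `A`
in cohomological degree `0` with zero differential and `H^{0,1} = ℤ 𝟙`, `H^{0,-1} = ℤ X`.
Bar-Natan (2002), §3.2: `V = ⟨v₊, v₋⟩` with `deg v± = ±1`, `⟦◯⟧ = V`, `n± = 0`, `𝒞(◯) = V`.

Proof (enhanced-state model of `KhComplex`). The empty Gauss diagram has no chord, so every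
incidence number `⟨d s, s'⟩` vanishes (it requires a `0`-smoothed chord of `s` to flip) and all
bigraded differentials `khovanovDQ` are zero (`khovanovDQ_empty`); hence
`Kh^{i,j} = ker 0 ⧸ (im 0 ⊓ ker 0)` is all of the cochain group `C^{i,j} = (bidegStates i j → ℤ)`
(`finrank_subquotient_of_eq_zero`), free of rank `#(bidegStates i j)`. The diagram has one arc
and one state circle (`card_stateCircle_empty`), so an enhanced state is determined by the label
of that circle (`EnhancedState.eq_of_label_eq_empty`) and has quantum degree `1` (label `𝟙`)
or `-1` (label `X`) (`qDegree_empty_eq`); with `homDegree = 0` (`homDegree_empty`) the bases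
`bidegStates 0 1 = {𝟙}` and `bidegStates 0 (-1) = {X}` are one-element types
(`card_bidegStates_empty_zero_one`, `card_bidegStates_empty_zero_neg_one`). -/

/-- For the empty diagram every bigraded Khovanov differential vanishes: a nonzero incidence
number `⟨d s, s'⟩` needs a `0`-smoothed chord of `s` to flip (`incidence`), and the empty
diagram has no chord. Khovanov (2000), §4.2 (the cube over `I = ∅` is a single vertex, the
complex of a crossingless diagram has zero differential). [cite: Khovanov2000, §4.2] -/
theorem khovanovDQ_empty (i i' j : ℤ) : GaussDiagram.empty.khovanovDQ i i' j = 0 := by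
  have h0 : (Matrix.of fun (s' : GaussDiagram.empty.bidegStates i' j)
      (s : GaussDiagram.empty.bidegStates i j) ↦
        GaussDiagram.empty.incidence ℤ 0 0 s.1 s'.1) = 0 := by
    ext s' s
    rw [Matrix.of_apply, Matrix.zero_apply, incidence, dif_neg]
    exact fun ⟨k, _⟩ ↦ k.elim0
  rw [khovanovDQ, h0, map_zero]

/-- Linear algebra of a complex `M → N → P` with zero differentials: if `f = 0` and `g = 0`,
the subquotient `ker g ⧸ (im f ⊓ ker g)` (the concrete homology used in `khovanovHomology`)
is linearly equivalent to the middle module `N`, so it has the same rank. [folklore] -/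
private theorem finrank_subquotient_of_eq_zero {R M N P : Type*} [Ring R] [AddCommGroup M]
    [Module R M] [AddCommGroup N] [Module R N] [AddCommGroup P] [Module R P]
    {f : M →ₗ[R] N} {g : N →ₗ[R] P} (hf : f = 0) (hg : g = 0) :
    Module.finrank R (↥(LinearMap.ker g) ⧸
        (LinearMap.range f).comap (LinearMap.ker g).subtype) = Module.finrank R N := by
  subst hf hg
  rw [LinearMap.range_zero, Submodule.comap_bot, Submodule.ker_subtype,
    (Submodule.quotEquivOfEqBot (⊥ : Submodule R ↥(LinearMap.ker (0 : N →ₗ[R] P))) rfl).finrank_eq,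
    LinearMap.ker_zero, finrank_top]

/-- An enhanced state of the empty diagram (round unknot) is determined by the label of its
single state circle, read off at any arc `a` (the diagram has one state, `Fin 0 → Bool`, and
one arc, `arcCount = max 0 1 = 1`): the two enhanced states are `𝟙` and `X`.
Bar-Natan (2002), §3.2 (`⟦◯⟧ = V = ⟨v₊, v₋⟩`). [cite: BarNatan2002, §3.2] -/
theorem EnhancedState.eq_of_label_eq_empty {s s' : GaussDiagram.empty.EnhancedState}
    (a : GaussDiagram.empty.Arc) (h : s.label a = s'.label a) : s = s' := by
  haveI : Subsingleton GaussDiagram.empty.Arc := inferInstanceAs (Subsingleton (Fin 1))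
  obtain ⟨σ, ℓ, hℓ⟩ := s
  obtain ⟨σ', ℓ', hℓ'⟩ := s'
  obtain rfl : σ = σ' := Subsingleton.elim (α := Fin 0 → Bool) _ _
  obtain rfl : ℓ = ℓ' := funext fun b ↦ by rw [Subsingleton.elim b a]; exact h
  rfl

/-- The quantum degree of an enhanced state of the empty diagram (round unknot) is `1` if its
single circle is labelled `𝟙` and `-1` if it is labelled `X` (the label read off at any arc
`a`): `deg 𝟙 = 1`, `deg X = -1` and the shift `|s| + n₊ - 2 n₋` vanishes. Khovanov (2000),
§7.1 (eq. before (149)); Bar-Natan (2002), §3.2 (`deg v± = ±1`). [cite: Khovanov2000, §7.1] -/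
theorem qDegree_empty_eq (s : GaussDiagram.empty.EnhancedState) (a : GaussDiagram.empty.Arc) :
    qDegree s = if s.label a then -1 else 1 := by
  haveI : Subsingleton GaussDiagram.empty.Arc := inferInstanceAs (Subsingleton (Fin 1))
  haveI : Subsingleton (GaussDiagram.empty.StateCircle s.state) :=
    Fintype.card_le_one_iff_subsingleton.mp (card_stateCircle_empty s.state).le
  -- the single state circle, counted once
  have huniv : (Finset.univ : Finset (GaussDiagram.empty.StateCircle s.state)).card = 1 := by
    rw [Finset.card_univ, card_stateCircle_empty]
  -- the circles labelled `b` are all of them or none, according to the label of the arc `a`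
  have hfilt : ∀ b : Bool,
      (Finset.univ.filter fun c : GaussDiagram.empty.StateCircle s.state ↦
        ∃ a, GaussDiagram.empty.circleOf s.state a = c ∧ s.label a = b) =
      if s.label a = b then Finset.univ else ∅ := by
    intro b
    split_ifs with hb
    · exact Finset.filter_eq_self.mpr fun c _ ↦ ⟨a, Subsingleton.elim _ _, hb⟩
    · refine Finset.filter_eq_empty_iff.mpr fun c _ h ↦ hb ?_
      obtain ⟨a', -, ha'⟩ := h
      rwa [Subsingleton.elim a a']
  rw [qDegree, hfilt false, hfilt true, State.weight_empty, nPlus_empty, nMinus_empty]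
  cases s.label a <;> simp [huniv]

/-- The basis `bidegStates 0 1` of `C^{0,1}(◯)` is the single enhanced state `𝟙`
(`oneStateEmpty`). Bar-Natan (2002), §3.2 (`deg v₊ = 1`, height `0`). [cite: BarNatan2002, §3.2] -/
theorem card_bidegStates_empty_zero_one :
    Fintype.card (GaussDiagram.empty.bidegStates 0 1) = 1 := by
  let a₀ : GaussDiagram.empty.Arc := ⟨0, by simp [arcCount]⟩
  refine Fintype.card_eq_one_iff.2
    ⟨⟨oneStateEmpty, homDegree_empty _, qDegree_oneStateEmpty⟩, ?_⟩
  rintro ⟨s, -, hs⟩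
  refine Subtype.ext (EnhancedState.eq_of_label_eq_empty a₀ ?_)
  rw [qDegree_empty_eq s a₀] at hs
  cases h : s.label a₀
  · rfl
  · rw [h] at hs
    exact absurd hs (by decide)

/-- The basis `bidegStates 0 (-1)` of `C^{0,-1}(◯)` is the single enhanced state `X` (the
state `Fin.elim0` with its circle labelled `X ↔ true`). Bar-Natan (2002), §3.2
(`deg v₋ = -1`, height `0`). [cite: BarNatan2002, §3.2] -/
theorem card_bidegStates_empty_zero_neg_one :
    Fintype.card (GaussDiagram.empty.bidegStates 0 (-1)) = 1 := by
  let a₀ : GaussDiagram.empty.Arc := ⟨0, by simp [arcCount]⟩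
  let sX : GaussDiagram.empty.EnhancedState := ⟨Fin.elim0, fun _ ↦ true, fun _ _ _ ↦ rfl⟩
  have hX : qDegree sX = -1 := by rw [qDegree_empty_eq sX a₀]; rfl
  refine Fintype.card_eq_one_iff.2 ⟨⟨sX, homDegree_empty _, hX⟩, ?_⟩
  rintro ⟨s, -, hs⟩
  refine Subtype.ext (EnhancedState.eq_of_label_eq_empty a₀ ?_)
  rw [qDegree_empty_eq s a₀] at hs
  cases h : s.label a₀
  · rw [h] at hs
    exact absurd hs (by decide)
  · rfl

/-- **`Kh^{0,1}(◯) ≅ ℤ`**: the named fact `finrank_khovanovHomology_empty_zero_one` of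
`KhComplex` holds — the Khovanov homology of the empty diagram (round unknot) in bidegree
`(0, 1)` is free of rank one, generated by the single circle labelled `𝟙`. The differentials of
the empty diagram vanish (`khovanovDQ_empty`), so `Kh^{0,1} = C^{0,1}` is free on
`bidegStates 0 1 = {𝟙}` (`card_bidegStates_empty_zero_one`). Khovanov (2000), §7.1
(`A = ℤ𝟙 ⊕ ℤX`, `deg 𝟙 = 1`) with §4.2 (a crossingless diagram has the one-vertex cube,
`C(D) = A` in degree `0`); Bar-Natan (2002), §3.2 (`𝒞(◯) = V`, `deg v₊ = 1`).
[cite: Khovanov2000, §7.1] -/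
theorem finrank_khovanovHomology_empty_zero_one_holds :
    finrank_khovanovHomology_empty_zero_one := by
  unfold finrank_khovanovHomology_empty_zero_one khovanovHomology
  exact (finrank_subquotient_of_eq_zero (khovanovDQ_empty _ _ _) (khovanovDQ_empty _ _ _)).trans
    ((Module.finrank_fintype_fun_eq_card _).trans card_bidegStates_empty_zero_one)

/-- **`Kh^{0,-1}(◯) ≅ ℤ`**: the named fact `finrank_khovanovHomology_empty_zero_neg_one` of
`KhComplex` holds — the Khovanov homology of the empty diagram (round unknot) in bidegree
`(0, -1)` is free of rank one, generated by the single circle labelled `X`. The differentials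
of the empty diagram vanish (`khovanovDQ_empty`), so `Kh^{0,-1} = C^{0,-1}` is free on
`bidegStates 0 (-1) = {X}` (`card_bidegStates_empty_zero_neg_one`). Khovanov (2000), §7.1
(`A = ℤ𝟙 ⊕ ℤX`, `deg X = -1`) with §4.2 (a crossingless diagram has the one-vertex cube,
`C(D) = A` in degree `0`); Bar-Natan (2002), §3.2 (`𝒞(◯) = V`, `deg v₋ = -1`).
[cite: Khovanov2000, §7.1] -/
theorem finrank_khovanovHomology_empty_zero_neg_one_holds :
    finrank_khovanovHomology_empty_zero_neg_one := by
  unfold finrank_khovanovHomology_empty_zero_neg_one khovanovHomology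
  exact (finrank_subquotient_of_eq_zero (khovanovDQ_empty _ _ _) (khovanovDQ_empty _ _ _)).trans
    ((Module.finrank_fintype_fun_eq_card _).trans card_bidegStates_empty_zero_neg_one)

end GaussDiagram

end Literature.Topology.FourManifolds
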